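import Summits.ResolutionOfSingularities.ResolutionOfSingularities.Theorems.FrobeniusClosingSteerCore4LowMultTwoCore
import Summits.ResolutionOfSingularities.ResolutionOfSingularities.Theorems.FrobeniusClosingSteerSwitchingAssembly
import Summits.ResolutionOfSingularities.ResolutionOfSingularities.Theorems.FrobeniusClosingSteerSwitchingSetup
import Mathlib.Algebra.CharP.Lemmas
import Mathlib.RingTheory.Derivation.Basic
import HarnessLib

/-!
# Crux `Steer` (stmt-ResolutionOfSingularities-16345), chain W4.1 — **S-B1ᴹ `NonResonantLogFinal`**:
# a non-resonant monomial model is a log-final model (pure algebra: `p`-strip + one cleaning)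

OURS (campaign `res-hironaka`, rung L, slot W4.1, chain W4.1; replaces the role of no printed item; NOT a
statement of the manuscript under review [claim: Hironaka2017, status: under-review]; AI review is weaker
than expert review).  Theses-free, definition-free helper for the REGISTERED r24 residual
`stub_nonSwitchingCoreM : NonSwitchingCoreM` of the line of record `Cruxes/Steer/Lines/switching_dichotomy.lean`
(holder res-L0-w41-lead-1) through res-L0-w41-idea-2's kernel-checked split
(`L/res-L0-w41-idea-2/Sketch-idea-2e.lean` §4)

  `nonSwitchingCoreM_of_budget : MonomialReachM → (∀ p, NonResonantLogFinal p) → EternalResonanceM → NonSwitchingCoreM`,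

whose SUPPORT input is

> **S-B1ᴹ `NonResonantLogFinal p`.** Let `A₀ ≤ A₁ ⊆ O` be a monomial model of the torsor (`A₁` finitely
> generated, consisting of fractions of `A₀`, `S := (A₁)_{𝔪_O ∩ A₁}` regular local) with exchanged radicand
> `t₂ ∉ Frac A₀`, `t₂ ^ p = z^m · u` monomial × unit in `S`.  If the model does NOT resonate, then `S` is
> LOG-FINAL for `t` (indeed of type E2: some exchanged radicand outside `Frac A₀` is TOROIDAL in `S`).

The main theorem `nonResonantLogFinal` is the LITERAL body of the sketch's `def NonResonantLogFinal (p : ℕ)`,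
with the sketch's vocabulary (`MonomialModelAt`, `ResonantModelAt`, `MonomialUnitAt`, `ResonantAt`,
`LogFinalAt`, `ToroidalAt`, `ContentInvertible`, `IsFracOf`) UNFOLDED verbatim, so that
`Idea2g4.NonResonantLogFinal p` closes by `exact nonResonantLogFinal p`.

## Proof (namespace `…Theorems.SwitchingDichotomy.NonResonantLogFinal`)

Non-resonance hands a presentation `t₂ ^ p = (∏ z_l ^ m_l) · u` (`z` an rsop part of `S`, `u ∈ S^×`) with
EITHER some `m_l` prime to `p` — then `t₂` itself is toroidal (E2) — OR all `p ∣ m_l` and a cleaning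
`c ∈ S` with `u − c ^ p ∈ 𝔪_S ∖ 𝔪_S²`.  In the second case put `m₀ := ∏ z_l ^ (m_l / p) ∈ S` and
`t₃ := t₂ / m₀ − c`: Frobenius gives `t₃ ^ p = u − c ^ p` (`sub_pow_char`), a ONE-ELEMENT part of a regular
system of parameters of the regular `S` (tree `LowMult.isRsopPart_one_of_not_mem_sq`) times the unit `1`
with exponent `1 ∤ p`; and `t₃ ∉ Frac A₀` because `m₀, c ∈ S ⊆ Subfield.closure A₀` (tree
`locAtCentre_le_subfield`, `exists_div_iff_mem_closure`) while `t₂ = (t₃ + c) · m₀ ∉ Frac A₀`.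

Elementary; no named facts, no definitions, no `sorry`. [cite: Posva2023, Lemma 9 (context: log-final
exits)] [cite: HeinzerEtAl2015, Prop. 4.4 (context: monomial × unit presentations along quadratic
sequences)] [folklore]
-/

noncomputable section

-- `Summit.<S>.<S>.…` duplicates the summit name by design (single-problem summit).
set_option linter.dupNamespace false
set_option autoImplicit false

namespace Summit.ResolutionOfSingularities.ResolutionOfSingularities.Theorems.SwitchingDichotomy.NonResonantLogFinal

open IsLocalRing
open Literature.AlgebraicGeometry.Resolution (locAtCentre IsRsopPart)
open Summit.ResolutionOfSingularities.ResolutionOfSingularities.Theorems.SwitchingDichotomy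
  (exists_div_iff_mem_closure locAtCentre_le_subfield)

/-! ### Two small lemmas on `Frac A₀` and on `p`-divisible monomials -/

section Lemmas

variable {k K : Type} [Field k] [Field K] [Algebra k K]

/-- The localisation at the centre of a model `A₁` consisting of fractions of `A₀` lies in the subfield
generated by `A₀`. [folklore] -/
theorem locAtCentre_le_closure (O : ValuationSubring K) (A₀ A₁ : Subalgebra k K)
    (hfrac : ∀ x ∈ A₁, ∃ y ∈ A₀, ∃ z ∈ A₀, z ≠ 0 ∧ x = y / z) :
    locAtCentre A₁.toSubring O ≤ (Subfield.closure (A₀ : Set K)).toSubring :=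
  locAtCentre_le_subfield O fun x hx => (exists_div_iff_mem_closure A₀ x).mp (hfrac x hx)

/-- `p`-STRIP: a monomial all of whose exponents are divisible by `p` is the `p`-th power of the monomial
with the divided exponents. [folklore] -/
theorem prod_pow_eq_pow_of_dvd {s : ℕ} (p : ℕ) (x : Fin s → K) (m : Fin s → ℕ) (hdiv : ∀ l, p ∣ m l) :
    (∏ l, x l ^ m l) = (∏ l, x l ^ (m l / p)) ^ p := by
  rw [← Finset.prod_pow]
  refine Finset.prod_congr rfl fun l _ => ?_
  rw [← pow_mul, Nat.div_mul_cancel (hdiv l)]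

end Lemmas

/-! ### S-B1ᴹ -/

/-- **S-B1ᴹ · `NonResonantLogFinal`, LITERAL** (body of res-L0-w41-idea-2's `Idea2g4.NonResonantLogFinal p`,
`Sketch-idea-2e.lean` §4 l.370, with `MonomialModelAt` / `ResonantModelAt` / `MonomialUnitAt` / `ResonantAt` /
`LogFinalAt` / `ToroidalAt` / `ContentInvertible` / `IsFracOf` unfolded verbatim): a NON-resonant monomial
model `(A₁, t₂)` of the torsor is log-final for `t` at `S = (A₁)_{𝔪_O ∩ A₁}` — by the exit E2 with `t₂`
itself (an exponent prime to `p`) or with the cleaned radicand `t₃ = t₂ / m₀ − c` (`t₃ ^ p = u − c ^ p` a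
regular parameter).  Closes the sketch def by `exact nonResonantLogFinal p`. [cite: Posva2023, Lemma 9]
[folklore] -/
theorem nonResonantLogFinal (p : ℕ) :
    ∀ (k K : Type) [Field k] [CharP k p] [Field K] [Algebra k K] [CharP K p]
      (O : ValuationSubring K) (A₀ A₁ : Subalgebra k K) (t t₂ : K),
      p.Prime → t ^ p ∈ A₀ →
      (∃ (_ : A₁.toSubring ≤ O.toSubring) (_ : IsLocalRing (locAtCentre A₁.toSubring O)),
        A₀ ≤ A₁ ∧ A₁.FG ∧ (∀ x ∈ A₁, ∃ y ∈ A₀, ∃ z ∈ A₀, z ≠ 0 ∧ x = y / z) ∧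
        IsRegularLocalRing (locAtCentre A₁.toSubring O) ∧
        ¬ (∃ y ∈ A₀, ∃ z ∈ A₀, z ≠ 0 ∧ t₂ = y / z) ∧
        ∃ (s : ℕ) (z : Fin s → locAtCentre A₁.toSubring O), IsRsopPart z ∧
          ∃ (m : Fin s → ℕ) (u : locAtCentre A₁.toSubring O), IsUnit u ∧
            t₂ ^ p = (∏ l, ((z l : locAtCentre A₁.toSubring O) : K) ^ m l) * (u : K)) →
      ¬ (∃ (_ : IsLocalRing (locAtCentre A₁.toSubring O)),
          ∀ (s : ℕ) (z : Fin s → locAtCentre A₁.toSubring O), IsRsopPart z →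
            ∀ (m : Fin s → ℕ) (u : locAtCentre A₁.toSubring O), IsUnit u →
              t₂ ^ p = (∏ l, ((z l : locAtCentre A₁.toSubring O) : K) ^ m l) * (u : K) →
                (∀ l, p ∣ m l) ∧ ∀ c : locAtCentre A₁.toSubring O,
                  u - c ^ p ∈ maximalIdeal (locAtCentre A₁.toSubring O) →
                    u - c ^ p ∈ (maximalIdeal (locAtCentre A₁.toSubring O)) ^ 2) →
      ∀ (_ : IsLocalRing (locAtCentre A₁.toSubring O)),
        (∃ f' : locAtCentre A₁.toSubring O, (f' : K) = t ^ p ∧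
            ∃ h : locAtCentre A₁.toSubring O, h ≠ 0 ∧
              (∀ δ : Derivation ℤ (locAtCentre A₁.toSubring O) (locAtCentre A₁.toSubring O),
                h ∣ δ f') ∧
              ∃ (δ : Derivation ℤ (locAtCentre A₁.toSubring O) (locAtCentre A₁.toSubring O))
                (u : locAtCentre A₁.toSubring O), IsUnit u ∧ δ f' = h * u) ∨
          (∃ t₂ : K, ¬ (∃ y ∈ A₀, ∃ z ∈ A₀, z ≠ 0 ∧ t₂ = y / z) ∧
            ∃ (s : ℕ) (z : Fin s → locAtCentre A₁.toSubring O), IsRsopPart z ∧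
              ∃ (m : Fin s → ℕ), (∃ l, ¬ p ∣ m l) ∧
                ∃ u : locAtCentre A₁.toSubring O, IsUnit u ∧
                  t₂ ^ p = (∏ l, ((z l : locAtCentre A₁.toSubring O) : K) ^ m l) * (u : K)) := by
  intro k K _ _ _ _ _ O A₀ A₁ t t₂ hp _htp hmod hnres hloc
  haveI : Fact p.Prime := ⟨hp⟩
  obtain ⟨_h₁, hloc', _hA, _hfg, hfrac, hreg, ht₂, -⟩ := hmod
  -- non-resonance: a presentation violating the resonance clause
  have H : ¬ ∀ (s : ℕ) (z : Fin s → locAtCentre A₁.toSubring O), IsRsopPart z →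
      ∀ (m : Fin s → ℕ) (u : locAtCentre A₁.toSubring O), IsUnit u →
        t₂ ^ p = (∏ l, ((z l : locAtCentre A₁.toSubring O) : K) ^ m l) * (u : K) →
          (∀ l, p ∣ m l) ∧ ∀ c : locAtCentre A₁.toSubring O,
            u - c ^ p ∈ maximalIdeal (locAtCentre A₁.toSubring O) →
              u - c ^ p ∈ (maximalIdeal (locAtCentre A₁.toSubring O)) ^ 2 :=
    fun h => hnres ⟨hloc, h⟩
  push Not at H
  obtain ⟨s, z, hz, m, u, hu, hg, hbad⟩ := H
  refine Or.inr ?_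
  by_cases hdiv : ∃ l, ¬ p ∣ m l
  · -- E2 with `t₂` itself
    exact ⟨t₂, ht₂, s, z, hz, m, hdiv, u, hu, hg⟩
  · -- all exponents divisible by `p`: strip and clean
    push Not at hdiv
    obtain ⟨c, hc1, hc2⟩ := hbad hdiv
    haveI : IsRegularLocalRing (locAtCentre A₁.toSubring O) := hreg
    -- the stripped monomial `m₀ = ∏ z_l ^ (m_l / p)`, as an element of `K`
    have hm₀S : (∏ l, ((z l : locAtCentre A₁.toSubring O) : K) ^ (m l / p)) ∈ locAtCentre A₁.toSubring O :=
      prod_mem fun l _ => pow_mem (z l).2 _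
    have hm₀0 : (∏ l, ((z l : locAtCentre A₁.toSubring O) : K) ^ (m l / p)) ≠ 0 := by
      refine Finset.prod_ne_zero_iff.mpr fun l _ => pow_ne_zero _ ?_
      intro h0
      exact hz.ne_zero l (Subtype.ext (by rw [h0]; rfl))
    have hprod : (∏ l, ((z l : locAtCentre A₁.toSubring O) : K) ^ m l) =
        (∏ l, ((z l : locAtCentre A₁.toSubring O) : K) ^ (m l / p)) ^ p :=
      prod_pow_eq_pow_of_dvd p _ m hdiv
    have hm₀p : (∏ l, ((z l : locAtCentre A₁.toSubring O) : K) ^ (m l / p)) ^ p ≠ 0 := pow_ne_zero _ hm₀0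
    -- the cleaned radicand `t₃ := t₂ / m₀ - c`
    have ht₃p : (t₂ / (∏ l, ((z l : locAtCentre A₁.toSubring O) : K) ^ (m l / p)) - (c : K)) ^ p =
        (((u - c ^ p : locAtCentre A₁.toSubring O)) : K) := by
      rw [sub_pow_char, div_pow, hg, hprod, mul_div_cancel_left₀ _ hm₀p]
      push_cast
      ring
    refine ⟨t₂ / (∏ l, ((z l : locAtCentre A₁.toSubring O) : K) ^ (m l / p)) - (c : K), ?_, 1,
      fun _ => u - c ^ p, LowMult.isRsopPart_one_of_not_mem_sq hc1 hc2, fun _ => 1,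
      ⟨0, fun h => hp.one_lt.ne' (Nat.dvd_one.mp h)⟩, 1, isUnit_one, ?_⟩
    · -- `t₃ ∉ Frac A₀`: else `t₂ = (t₃ + c) · m₀ ∈ Frac A₀`
      intro hfr
      apply ht₂
      have hSF : locAtCentre A₁.toSubring O ≤ (Subfield.closure (A₀ : Set K)).toSubring :=
        locAtCentre_le_closure O A₀ A₁ hfrac
      have hcF : (c : K) ∈ Subfield.closure (A₀ : Set K) := hSF c.2
      have hm₀F : (∏ l, ((z l : locAtCentre A₁.toSubring O) : K) ^ (m l / p)) ∈
          Subfield.closure (A₀ : Set K) := hSF hm₀S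
      have ht₃F := (exists_div_iff_mem_closure A₀ _).mp hfr
      refine (exists_div_iff_mem_closure A₀ t₂).mpr ?_
      have ht₂eq : t₂ = (t₂ / (∏ l, ((z l : locAtCentre A₁.toSubring O) : K) ^ (m l / p)) - (c : K) + c) *
          (∏ l, ((z l : locAtCentre A₁.toSubring O) : K) ^ (m l / p)) := by
        rw [sub_add_cancel, div_mul_cancel₀ _ hm₀0]
      rw [ht₂eq]
      exact mul_mem (add_mem ht₃F hcF) hm₀F
    · rw [Fin.prod_univ_one, pow_one, OneMemClass.coe_one, mul_one, ht₃p]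

end Summit.ResolutionOfSingularities.ResolutionOfSingularities.Theorems.SwitchingDichotomy.NonResonantLogFinal
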